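import Literature.Geometry.Riemannian.CutLocus
import HarnessLib

/-!
# Bishop 1977: the ordinary cut points are dense in the cut locus

Topic `Geometry/Riemannian`; sequel of `CutLocus.lean` (metric definitions `cutLocus g hg p` and
`minimalGeodesicMultiplicity g hg p q` of route `SmoothPoincare4/CutLocusSpine`). Requested by
the cite item "Bishop 1977 — the cut locus is the closure of the set of points joined to `p` by
at least two minimal geodesics" of that route.

What is printed. R. L. Bishop, *Decomposition of cut loci*, Proc. AMS 65 (1977) 133–136, for a
complete Riemannian manifold `M` and `m ∈ M`: a cut point `p` of `m` is *ordinary* if there are two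
or more minimizing segments from `m` to `p`, *singular* otherwise (p. 133); **Main Theorem
(p. 133): "The ordinary cut-points of `m` are dense in the cut-locus of `m` and the ordinary
tangent cut-points are dense in the tangent cut-locus."** Together with two textbook facts — a
point joined to `m` by two or more minimizing segments is a cut point ("well-known
characterization", Bishop p. 133 quoting Bishop–Crittenden p. 237; Lee 2018, Prop. 10.32 (a):
before the cut time the minimizing geodesic is unique), and the cut locus of a complete
connected manifold is closed (Lee 2018, Thm. 10.34 (a)) — this gives the form used by the route:
`Cut(p) = closure {q | at least two minimal geodesics from p to q}`.

This file vendors, in the metric vocabulary of `CutLocus.lean` (which on complete connected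
Riemannian manifolds agrees with the classical notions, see that file's module docstring:
`q ∈ cutLocus ↔ q` is a cut point of `p`; midpoints `↔` minimal geodesics, so "ordinary" `↔`
`2 ≤ minimalGeodesicMultiplicity`):

* the named fact `bishop1977_ordinary_dense` — **Bishop's Main Theorem, first half**:
  `cutLocus g hg p ⊆ closure {q ∈ cutLocus g hg p | 2 ≤ minimalGeodesicMultiplicity g hg p q}`;
  the second half (tangent cut locus) needs the exponential map, which the tree does not have for
  `PseudoRiemannianMetric`, and is NOT vendored;
* the named fact `cutLocus_isClosed_and_mem_of_two_le` — **Lee 2018, Thm. 10.34 (a) and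
  Prop. 10.32 (a)** in the same vocabulary: the cut locus is closed, and a point of multiplicity
  `≥ 2` lies in the cut locus;
* PROVED consequences: `cutLocus_eq_closure_setOf_two_le` — **`Cut(p) = closure {q | mult ≥ 2}`**
  (the item's form), and `exists_two_le_multiplicity_of_cutLocus_nonempty` — if the cut locus of
  `p` is non-empty then some point has multiplicity `≥ 2` (from Bishop's density alone; "the
  multiplicity ladder starts at `N ≤ 2`" once `Cut(p) ≠ ∅`, e.g. on compact manifolds, a
  classical fact not vendored here); `properBalls_of_compactSpace` — compact manifolds satisfy the
  completeness hypothesis below.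

Hypotheses (both facts). `M` a connected Hausdorff boundaryless `C^∞` manifold over a
finite-dimensional model, `g` a `C^∞` Riemannian metric, and **completeness** in the
Heine–Borel form "closed distance balls of finite radius are compact"
(`∀ x r, IsCompact {y | d(x,y) ≤ r}`, `r : ℝ≥0`), which for Riemannian manifolds is equivalent to
metric/geodesic completeness (Hopf–Rinow; Lee 2018, Thm. 6.19) — the tree has no completeness
predicate for `g.edist`, and this is the form the proofs use. Bishop's and Lee's statements are
for complete (connected) manifolds; nothing here is stated beyond that setting.

Mathlib/tree search: no cut locus, exponential map of a Riemannian metric, Hopf–Rinow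
(`lean search 'cutLocus|HopfRinow|cut_locus'`: only `CutLocus.lean`).

## References

* R. L. Bishop, *Decomposition of cut loci*, Proc. Amer. Math. Soc. 65 (1977) 133–136: p. 133
  (definitions, Main Theorem, the well-known characterization [1, p. 237]), §4 pp. 135–136
  (proof). [Bishop1977]
* J. M. Lee, *Introduction to Riemannian Manifolds*, 2nd ed., GTM 176 (2018): Prop. 10.32,
  Thm. 10.33, Thm. 10.34 (a) (pp. 308–311). [LeeRiemannianManifolds2018]
* R. L. Bishop, R. J. Crittenden, *Geometry of Manifolds* (1964), pp. 237–239.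
-/

noncomputable section

open Set Manifold
open scoped Manifold ContDiff Topology ENNReal NNReal

namespace Literature.Geometry.Riemannian

open Literature.Geometry.Lorentzian (PseudoRiemannianMetric)

/-! ### The two named facts -/

/-- **Bishop 1977, Main Theorem (first half)** (Proc. AMS 65, p. 133: "The ordinary cut-points of
`m` are dense in the cut-locus of `m`"; an ordinary cut point is a cut point reached from `m` by
two or more minimizing segments). For a connected complete (closed balls compact) `C^∞`
Riemannian manifold and `p ∈ M`, in the metric vocabulary of `CutLocus.lean`: every point of the
cut locus of `p` is a limit of cut points of `p` of minimal-geodesic multiplicity `≥ 2`.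
(The second half, density of ordinary tangent cut points in the tangent cut locus, is not
vendored.) [cite: Bishop1977, Main Theorem (p. 133)] -/
def bishop1977_ordinary_dense : Prop :=
  ∀ {E : Type*} [NormedAddCommGroup E] [NormedSpace ℝ E] [FiniteDimensional ℝ E]
    {H : Type*} [TopologicalSpace H] (I : ModelWithCorners ℝ E H) [I.Boundaryless]
    {M : Type*} [TopologicalSpace M] [ChartedSpace H M] [IsManifold I ∞ M]
    [T2Space M] [ConnectedSpace M]
    (g : PseudoRiemannianMetric I ∞ E (TangentSpace I : M → Type _)) (hg : g.IsRiemannian),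
    (∀ (x : M) (r : ℝ≥0), IsCompact {y | g.edist hg x y ≤ r}) →
    ∀ p : M, cutLocus g hg p ⊆
      closure {q | q ∈ cutLocus g hg p ∧ 2 ≤ minimalGeodesicMultiplicity g hg p q}

/-- **The cut locus is closed, and points of multiplicity `≥ 2` are cut points** (Lee 2018,
Thm. 10.34 (a): "The cut locus of `p` is a closed subset of `M` of measure zero" — only
closedness is vendored; Prop. 10.32 (a): before the cut time "`γ_v|[0,b]` … is the unique
unit-speed minimizing curve between its endpoints", so a point joined to `p` by two distinct
minimal geodesics — two distinct midpoints — is the cut point along each, and no minimal segment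
from `p` extends beyond it; Bishop 1977 p. 133 quotes this "well-known characterization" from
Bishop–Crittenden p. 237). Same hypotheses and vocabulary as `bishop1977_ordinary_dense`.
[cite: LeeRiemannianManifolds2018, Thm. 10.34 (a) and Prop. 10.32 (a)] -/
def cutLocus_isClosed_and_mem_of_two_le : Prop :=
  ∀ {E : Type*} [NormedAddCommGroup E] [NormedSpace ℝ E] [FiniteDimensional ℝ E]
    {H : Type*} [TopologicalSpace H] (I : ModelWithCorners ℝ E H) [I.Boundaryless]
    {M : Type*} [TopologicalSpace M] [ChartedSpace H M] [IsManifold I ∞ M]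
    [T2Space M] [ConnectedSpace M]
    (g : PseudoRiemannianMetric I ∞ E (TangentSpace I : M → Type _)) (hg : g.IsRiemannian),
    (∀ (x : M) (r : ℝ≥0), IsCompact {y | g.edist hg x y ≤ r}) →
    ∀ p : M, IsClosed (cutLocus g hg p) ∧
      ∀ q : M, 2 ≤ minimalGeodesicMultiplicity g hg p q → q ∈ cutLocus g hg p

/-! ### Consequences -/

section Consequences

universe u v w

variable {E : Type u} [NormedAddCommGroup E] [NormedSpace ℝ E] [FiniteDimensional ℝ E]
  {H : Type v} [TopologicalSpace H] {I : ModelWithCorners ℝ E H} [I.Boundaryless]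
  {M : Type w} [TopologicalSpace M] [ChartedSpace H M] [IsManifold I ∞ M]
  [T2Space M] [ConnectedSpace M]
  {g : PseudoRiemannianMetric I ∞ E (TangentSpace I : M → Type _)} {hg : g.IsRiemannian}

/-- **`Cut(p) = closure {q | multiplicity ≥ 2}`** (the form requested by route `CutLocusSpine`):
the cut locus of `p` is the closure of the set of points joined to `p` by at least two minimal
geodesics — from Bishop's density (`⊆`) and Lee 2018, Thm. 10.34 (a) / Prop. 10.32 (a)
(closedness and `{mult ≥ 2} ⊆ Cut(p)`, giving `⊇` and identifying Bishop's ordinary cut points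
with `{mult ≥ 2}`). [cite: Bishop1977, Main Theorem (p. 133)] -/
theorem cutLocus_eq_closure_setOf_two_le (hB : bishop1977_ordinary_dense.{u, v, w})
    (hL : cutLocus_isClosed_and_mem_of_two_le.{u, v, w})
    (hc : ∀ (x : M) (r : ℝ≥0), IsCompact {y | g.edist hg x y ≤ r}) (p : M) :
    cutLocus g hg p = closure {q | 2 ≤ minimalGeodesicMultiplicity g hg p q} := by
  obtain ⟨hclosed, hmem⟩ := hL I g hg hc p
  have hset : {q | q ∈ cutLocus g hg p ∧ 2 ≤ minimalGeodesicMultiplicity g hg p q} =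
      {q | 2 ≤ minimalGeodesicMultiplicity g hg p q} :=
    Set.ext fun q => ⟨fun h => h.2, fun h => ⟨hmem q h, h⟩⟩
  refine Subset.antisymm ?_ ?_
  · have h := hB I g hg hc p
    rwa [hset] at h
  · rw [← hset]
    exact closure_minimal (fun q hq => hq.1) hclosed

/-- **The multiplicity ladder starts at `N ≤ 2`**: if the cut locus of `p` is non-empty, some
point is joined to `p` by at least two minimal geodesics (from Bishop's density alone: a
non-empty set has non-empty dense subsets). On a compact manifold `Cut(p) ≠ ∅` for every `p`
(classical; not vendored). [cite: Bishop1977, Main Theorem (p. 133)] -/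
theorem exists_two_le_multiplicity_of_cutLocus_nonempty (hB : bishop1977_ordinary_dense.{u, v, w})
    (hc : ∀ (x : M) (r : ℝ≥0), IsCompact {y | g.edist hg x y ≤ r}) {p : M}
    (hne : (cutLocus g hg p).Nonempty) :
    ∃ q, q ∈ cutLocus g hg p ∧ 2 ≤ minimalGeodesicMultiplicity g hg p q := by
  obtain ⟨q, hq⟩ := hne
  have hq' := hB I g hg hc p hq
  by_contra h
  push Not at h
  have hempty : {q | q ∈ cutLocus g hg p ∧ 2 ≤ minimalGeodesicMultiplicity g hg p q} = ∅ :=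
    Set.eq_empty_of_forall_notMem fun r hr => (h r hr.1).not_ge hr.2
  rw [hempty, closure_empty] at hq'
  exact hq'

omit [I.Boundaryless] [ConnectedSpace M] in
/-- On a compact (Hausdorff) manifold the completeness hypothesis of the facts holds: closed
distance balls are compact (closed subsets of a compact space; the distance is continuous,
`PseudoRiemannianMetric.continuous_edist`). [folklore] -/
theorem properBalls_of_compactSpace [CompactSpace M] (hg : g.IsRiemannian) (x : M) (r : ℝ≥0) :
    IsCompact {y | g.edist hg x y ≤ r} := by
  refine IsClosed.isCompact ?_
  have hcont : Continuous fun y : M => g.edist hg x y :=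
    (PseudoRiemannianMetric.continuous_edist hg).comp (Continuous.prodMk_right x)
  exact isClosed_le hcont continuous_const

end Consequences

end Literature.Geometry.Riemannian
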